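import Summits.HodgeConjecture.HodgeConjecture.Theorems.Ring2AbelianAllWeilTwistedProducts
import Summits.HodgeConjecture.HodgeConjecture.Theorems.Ring2AbelianAllWeilHyperbolicRungs
import Literature.AlgebraicGeometry.HodgeTheory.WeilTypeHodgeRing
import Literature.AlgebraicGeometry.HodgeTheory.WeilClassesTwistedSquare
import Literature.AlgebraicGeometry.VanGeemen1994.WeilDiscriminantOfHyperbolic
import HarnessLib

/-!
# Ring 2 · AbelianAll — ANDRÉ AXIS, PART XLIX-a: THE WEIL PLANES OF ISODISCRIMINANTAL TWISTED PRODUCTS `X_s × X̄_t`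
  ARE ALGEBRAIC GRANTED THE SPLIT RUNG IN HALF-DIMENSION `2n` (owed item (o149), on top of ab-weil-1's twisted-product discriminant)

HONEST FRAMING (sub-cell `pub-hodge-ring2-ab-*`, verbatim): research route, not a corollary; conditional on HC_CM plus
one named minimal statement. (Cell `pub-hodge-ring2`, verbatim: research route conditional on HC_CM; not a corollary;
Q11.4-sentence-2 already refuted in dim ≥ 3.) `HC_CM` does not occur in this file. No definition, no named fact, no
`sorry`; ABELIAN-VARIETY level (no pencil). §§1–2 are fact-free; §3 takes the cell's typed nodes
`Stubs.WeilAlgebraicSplitHyperplane (n + n) d` (crux line `e-step-secant-induction`), `WeilTypeLadder.SplitWeilAbelianVarieties`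
(R2) and `Ring2.Hypotheses.WeilClassesComponent (n + n) d [1]` as BINDERS (hypotheses, never facts); §4 is on-path.

CONTEXT. Part XLVIII (gen 40) proved, for compact pencils of `ℚ(√−d)`-Weil `2n`-folds, `β ⟸` [the Weil PLANES
`weilClassesOf (A_s × A_t) Φ_s (2n) d` of the conjugate-twisted products `(X_s × X_t, φ_s × (−φ_t))` are algebraic for
uncountably many `s`] `+ Verdier` (`…AndreTwistedProductRows`, hypothesis `hW`), and left the dictionary "`X_s × X̄_t` is a SPLIT
Weil `4n`-fold" in print only (owed (o149)). Seat ab-weil-1 (gen 108, `Ring2AbelianAllWeilTwistedProducts`, landed while this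
part was being written) has now put the discriminant half in the kernel: `hasWeilDiscriminantNondeg_neg_iff` (`det H` is blind
to `φ ↦ −φ`), `isSplitWeilType_twistedProd_of_class_eq` (**two members of ONE component `(n, d, δ)` have a twisted product of
SPLIT Weil type**) and the edge from the cell's split component to the RATIONAL HODGE Weil classes of the twisted product —
explicitly NOT the Weil plane. This file closes the remaining gap to part XLVIII-c's hypothesis `hW`, which is about the PLANE:

* §1 `isSplitWeilType_twistedProd_of_comm` — ab-weil-1's split theorem for an ABSTRACT endomorphism `Φ` of `A × B` with
  `Φ ≫ pr₁ = pr₁ ≫ φ`, `Φ ≫ pr₂ = pr₂ ≫ (−ψ)` (the shape in which part XLVIII-c charts the twisted structures; `Φ = φ × (−ψ)`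
  by `AbelianVariety.prod_hom_ext`).
* §2 **`isSplitWeilType_twistedSquare` — the twisted square `(A × A, φ × (−φ))` of EVERY Weil-type pair is of split Weil
  type** (a pair is isodiscriminantal with itself; embedding and class from `VanGeemen1994.exists_projectiveEmbedding_hasWeilDiscriminantNondeg`);
  for comparison `weilClassesOf_twistedSquare_algebraic` records the Hodge–Weil ladder's stronger fact that its Weil plane is
  even ALGEBRAIC outright (`HodgeTheory.weilClassesOf_twistedSquare_le_algebraicClasses`) — the member `s = t` of part XLVIII-i.
* §3 **THE WEIL PLANE BY NODE.** For `(A, φ)`, `(B, ψ)` of Weil type `(n, n)` in one component `(n, d, δ)` and any such `Φ`: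
  `weilClassesOf (A × B) Φ (n + n) d ≤ N^{n+n}(A × B)` granted EITHER the slice `Stubs.WeilAlgebraicSplitHyperplane (n + n) d`
  (`…_of_splitHyperplane`), OR the summit-side rung `SplitWeilAbelianVarieties` when `n ≥ 2`
  (`…_of_splitWeilAbelianVarieties`, through ab-weil's `splitWeilAbelianVarieties_iff_forall_splitHyperplane`), OR the cell's
  split component `WeilClassesComponent (n + n) d [1]` (`…_of_split_component`). The step from rational Hodge classes to the
  plane is van Geemen 4.9 on the carriers (`IsWeilType.weilClassesOf_le_algebraicClasses`: under Weil type the plane is the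
  complex span of its rational `(N,N)` classes), applied to the twisted product, which IS of Weil type `(2n, 2n)`
  (`IsWeilType.neg`, `isWeilType_prod`). W₆, member level: `weilClassesOf_twistedTwelvefold_le_algebraicClasses_of_splitWeilAbelianVarieties`.
* §4 on-path: all of §3 are cases of the summit (`weilClassesOf_twistedProd_le_algebraicClasses_of_hodgeConjecture`).

HONEST COMPARISON. "Isodiscriminantal" (same class `δ`) is automatic in print for two members of one polarized family with
flat `K`-action (local constancy of `det H`); on the carriers it is a hypothesis (no parallel transport in `R¹f_*ℚ`). At NODE
level the rung `(2n, d)` used here and the rung `(n + 1, d)` of part XLIV-f (`SplitEightfolds ⟹ W₆` by the tree's Schoen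
descent `stub_descend`) both lie below `SplitWeilAbelianVarieties`; `R2₈ = SplitEightfolds` is the `n = 4` instance of R2, so
for W₆ the present edge (R2 at `n = 6`) is DOMINATED by part XLIV-f at node level. Its content is the exact dictionary: the
hypothesis `hW` of part XLVIII-c is an instance of the split rung `(2n, d)` for split `4n`-folds OF PRODUCT SHAPE, and
conversely (part XLVIII-f, fact-free) `B⋆(𝒳) ∀η` forces these instances. No case of the Hodge conjecture is claimed; nothing
minimal is claimed; N104 untouched. The pencil rows are part XLIX-b.

## References

* [vanGeemen1994HodgeAV] B. van Geemen, An introduction to the Hodge conjecture for abelian varieties, LNM 1594 (1994),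
  4.9, Lemma 5.2 (2)–(4), 5.4 and (5.4.1), proof of Thm. 6.12.
* [Landherr1936HermitianForms] W. Landherr, Abh. Math. Sem. Hamburg 11 (1936) 245–248.
* [Schoen1998HodgeWeilAddendum] C. Schoen, Compositio Math. 114 (1998), §10.
* [Markman2025SurveySecant] E. Markman, arXiv:2509.23403, §11.5 Step 2 and §12 (preprint, unrefereed).
* [Deligne2000] P. Deligne, The Hodge conjecture (Clay problem description, 2000), §1.
-/

set_option linter.dupNamespace false

noncomputable section

open CategoryTheory

namespace Summit.HodgeConjecture.HodgeConjecture.Ring2.AbelianAll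

open Literature.AlgebraicGeometry Literature.AlgebraicGeometry.Motives
open Literature.AlgebraicGeometry.HodgeTheory Literature.AlgebraicGeometry.VanGeemen1994
open Literature.AlgebraicTopology.SingularHomology
open Summit.HodgeConjecture.HodgeConjecture.WeilTypeLadder
open Summit.HodgeConjecture.HodgeConjecture.Theses
open Summit.HodgeConjecture.HodgeConjecture.Ring2.Hypotheses
open Summit.HodgeConjecture.HodgeConjecture.Cruxes.HodgeAbelianVarieties.EStepSecantInduction (WeilAlgebraicFor)
open Summit.HodgeConjecture.HodgeConjecture.Cruxes.HodgeAbelianVarieties.EStepSecantInduction.Stubs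
  (WeilAlgebraicSplitHyperplane)

/-! ## §1 The twisted structure as an abstract endomorphism of `A × B` -/

section Abstract

variable {A B : AbelianVariety ℂ} {φ : A ⟶ A} {ψ : B ⟶ B} {n d : ℕ}

/-- An endomorphism of `A × B` commuting with the projections onto `φ` and `ψ'` IS `φ × ψ'`
(`AbelianVariety.prod_hom_ext`). [folklore] -/
theorem eq_prodLift_of_comp_fst_snd {ψ' : B ⟶ B} {Φ : A.prod B ⟶ A.prod B}
    (h₁ : Φ ≫ AbelianVariety.fst A B = AbelianVariety.fst A B ≫ φ)
    (h₂ : Φ ≫ AbelianVariety.snd A B = AbelianVariety.snd A B ≫ ψ') :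
    Φ = AbelianVariety.prodLift (AbelianVariety.fst A B ≫ φ) (AbelianVariety.snd A B ≫ ψ') :=
  AbelianVariety.prod_hom_ext (by rw [h₁, AbelianVariety.prodLift_fst]) (by rw [h₂, AbelianVariety.prodLift_snd])

/-- **Two members of one component `(n, d, δ)` have a conjugate-twisted product of SPLIT Weil type `(2n, 2n)`** — ab-weil-1's
`isSplitWeilType_twistedProd_of_class_eq`, for ANY endomorphism `Φ` of `A × B` with `Φ ≫ pr₁ = pr₁ ≫ φ` and
`Φ ≫ pr₂ = pr₂ ≫ (−ψ)` (the shape in which part XLVIII-c charts the twisted structures `Φ_s` of a pencil).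
[cite: vanGeemen1994HodgeAV, Lemma 5.2 (2)–(4), 5.4 and (5.4.1)] [cite: Landherr1936HermitianForms] -/
theorem isSplitWeilType_twistedProd_of_comm (hWA : IsWeilType A φ n d) (hWB : IsWeilType B ψ n d)
    (eA : ProjectiveEmbedding A.X) {aA : complexBetti (projectiveSpace eA.n ℂ) 2} (haA : IsRationalClass aA)
    (haA0 : aA ≠ 0)
    (eB : ProjectiveEmbedding B.X) {aB : complexBetti (projectiveSpace eB.n ℂ) 2} (haB : IsRationalClass aB)
    (haB0 : aB ≠ 0) {δ : weilNormResidueGroup d}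
    (hδA : HasWeilDiscriminantNondeg A φ n d
      ((d : ℂ) • complexBetti.map eA.ι 2 aA + complexBetti.map φ.hom.hom.hom 2 (complexBetti.map eA.ι 2 aA)) δ)
    (hδB : HasWeilDiscriminantNondeg B ψ n d
      ((d : ℂ) • complexBetti.map eB.ι 2 aB + complexBetti.map ψ.hom.hom.hom 2 (complexBetti.map eB.ι 2 aB)) δ)
    (Φ : A.prod B ⟶ A.prod B) (hΦ₁ : Φ ≫ AbelianVariety.fst A B = AbelianVariety.fst A B ≫ φ)
    (hΦ₂ : Φ ≫ AbelianVariety.snd A B = AbelianVariety.snd A B ≫ (-ψ)) :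
    IsSplitWeilType (A.prod B) Φ (n + n) d := by
  obtain rfl := eq_prodLift_of_comp_fst_snd hΦ₁ hΦ₂
  exact isSplitWeilType_twistedProd_of_class_eq hWA hWB eA haA haA0 eB haB haB0 hδA hδB

end Abstract

/-! ## §2 The twisted square is always split -/

section Square

variable {A : AbelianVariety ℂ} {φ : A ⟶ A} {n d : ℕ}

/-- **THE TWISTED SQUARE `(A × A, φ × (−φ))` OF EVERY WEIL-TYPE PAIR IS OF SPLIT WEIL TYPE** (no hypothesis beyond Weil
type `(n, n)`: a pair is isodiscriminantal with itself; the embedding and the class are van Geemen's Lemma 5.2 (1)–(3) on the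
carriers, `exists_projectiveEmbedding_hasWeilDiscriminantNondeg`). For the untwisted square `φ × φ` this is ab-weil-2's
`isSplitWeilType_self_prod`. [cite: vanGeemen1994HodgeAV, Lemma 5.2 (1)–(3), 5.4 and (5.4.1)] [cite: Landherr1936HermitianForms]
[cite: Schoen1998HodgeWeilAddendum, §10] -/
theorem isSplitWeilType_twistedSquare (hW : IsWeilType A φ n d) :
    IsSplitWeilType (A.prod A)
      (AbelianVariety.prodLift (AbelianVariety.fst A A ≫ φ) (AbelianVariety.snd A A ≫ (-φ))) (n + n) d := by
  obtain ⟨e, a, δ, ha, ha0, hδ⟩ := exists_projectiveEmbedding_hasWeilDiscriminantNondeg hW.pos hW.dim_eq hW.d_pos hW.sq_eq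
  exact isSplitWeilType_twistedProd_of_class_eq hW hW e ha ha0 e ha ha0 hδ hδ

/-- For comparison (the Hodge–Weil ladder's theorem, not re-proved): **the Weil plane of the twisted square is even
ALGEBRAIC outright**, for every complex abelian variety `A` of dimension `g ≥ 1` and every `φ` with `φ² = −d`, `d ≥ 1`
(`HodgeTheory.weilClassesOf_twistedSquare_le_algebraicClasses`: the Weil line of the twisted square is a Lagrange projection
of the pull-back of a point class along the group law). In the André axis this is the member `s = t` of the twisted family
(part XLVIII-i: its Weil plane carries the invariant projector `P_t`) — the anchor showing why β needs two DIFFERENT members.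
[cite: Schoen1998HodgeWeilAddendum, §10] [cite: vanGeemen1994HodgeAV, 4.9 and proof of Thm. 6.12] -/
theorem weilClassesOf_twistedSquare_algebraic {g : ℕ} (hg : 0 < g) (hA : A.dim = g) (hd : 0 < d)
    (hφ : φ ≫ φ = -(d • 𝟙 A)) :
    weilClassesOf (A.prod A)
        (AbelianVariety.prodLift (AbelianVariety.fst A A ≫ φ) (AbelianVariety.snd A A ≫ (-φ))) g d ≤
      algebraicClasses (A.prod A).X g :=
  weilClassesOf_twistedSquare_le_algebraicClasses hg hA hd hφ

end Square

/-! ## §3 The Weil PLANE of an isodiscriminantal twisted product, by node -/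

section Nodes

variable {A B : AbelianVariety ℂ} {φ : A ⟶ A} {ψ : B ⟶ B} {n d : ℕ}

/-- **Binder: the slice `Stubs.WeilAlgebraicSplitHyperplane (n + n) d`** (Weil classes algebraic on split `ℚ(√−d)`-Weil
`4n`-folds polarized by a `K`-symmetrised hyperplane class) **⟹ the Weil PLANE of the twisted product of two members of one
component `(n, d, δ)` is algebraic.** The twisted product is split (§1), i.e. hyperbolic for some `K`-symmetrised hyperplane
class; the slice gives `WeilAlgebraicFor`; and under Weil type `(2n, 2n)` (`IsWeilType.neg`, `isWeilType_prod`) the plane is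
the complex span of its rational `(2n, 2n)` classes (`IsWeilType.weilClassesOf_le_algebraicClasses`, van Geemen 4.9). This is
EXACTLY one member of the set in the hypothesis `hW` of part XLVIII-c's `betaInverse_of_weilPlanes_twistedProd_of_verdier`.
[cite: vanGeemen1994HodgeAV, 4.9, Lemma 5.2 (3) and (5.4.1)] [cite: Markman2025SurveySecant, §11.5] -/
theorem weilClassesOf_twistedProd_le_algebraicClasses_of_splitHyperplane (hSp : WeilAlgebraicSplitHyperplane (n + n) d)
    (hWA : IsWeilType A φ n d) (hWB : IsWeilType B ψ n d)
    (eA : ProjectiveEmbedding A.X) {aA : complexBetti (projectiveSpace eA.n ℂ) 2} (haA : IsRationalClass aA)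
    (haA0 : aA ≠ 0)
    (eB : ProjectiveEmbedding B.X) {aB : complexBetti (projectiveSpace eB.n ℂ) 2} (haB : IsRationalClass aB)
    (haB0 : aB ≠ 0) {δ : weilNormResidueGroup d}
    (hδA : HasWeilDiscriminantNondeg A φ n d
      ((d : ℂ) • complexBetti.map eA.ι 2 aA + complexBetti.map φ.hom.hom.hom 2 (complexBetti.map eA.ι 2 aA)) δ)
    (hδB : HasWeilDiscriminantNondeg B ψ n d
      ((d : ℂ) • complexBetti.map eB.ι 2 aB + complexBetti.map ψ.hom.hom.hom 2 (complexBetti.map eB.ι 2 aB)) δ)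
    (Φ : A.prod B ⟶ A.prod B) (hΦ₁ : Φ ≫ AbelianVariety.fst A B = AbelianVariety.fst A B ≫ φ)
    (hΦ₂ : Φ ≫ AbelianVariety.snd A B = AbelianVariety.snd A B ≫ (-ψ)) :
    weilClassesOf (A.prod B) Φ (n + n) d ≤ algebraicClasses (A.prod B).X (n + n) := by
  obtain ⟨hWP, e, a, ha, ha0, hhyp⟩ :=
    isSplitWeilType_twistedProd_of_comm hWA hWB eA haA haA0 eB haB haB0 hδA hδB Φ hΦ₁ hΦ₂
  exact hWP.weilClassesOf_le_algebraicClasses fun c hc hr hH => hSp _ Φ e a hWP.dim_eq hWP.sq_eq ha ha0 hhyp c hc hr hH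

/-- **Binder: the summit-side rung `WeilTypeLadder.SplitWeilAbelianVarieties` (R2, split `2N`-folds, every `N ≥ 4`)** ⟹ the
same conclusion whenever `n ≥ 2` (twisted products of dimension `4n ≥ 8`; for `n = 2` the rung used is `R2₈ = SplitEightfolds`'s
dimension, for `n = 3` the split TWELVEFOLDS). Through ab-weil's re-indexing `splitWeilAbelianVarieties_iff_forall_splitHyperplane`.
[cite: Markman2025SurveySecant, §12] [cite: vanGeemen1994HodgeAV, 4.9 and (5.4.1)] -/
theorem weilClassesOf_twistedProd_le_algebraicClasses_of_splitWeilAbelianVarieties (hR2 : SplitWeilAbelianVarieties)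
    (hn : 2 ≤ n) (hWA : IsWeilType A φ n d) (hWB : IsWeilType B ψ n d)
    (eA : ProjectiveEmbedding A.X) {aA : complexBetti (projectiveSpace eA.n ℂ) 2} (haA : IsRationalClass aA)
    (haA0 : aA ≠ 0)
    (eB : ProjectiveEmbedding B.X) {aB : complexBetti (projectiveSpace eB.n ℂ) 2} (haB : IsRationalClass aB)
    (haB0 : aB ≠ 0) {δ : weilNormResidueGroup d}
    (hδA : HasWeilDiscriminantNondeg A φ n d
      ((d : ℂ) • complexBetti.map eA.ι 2 aA + complexBetti.map φ.hom.hom.hom 2 (complexBetti.map eA.ι 2 aA)) δ)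
    (hδB : HasWeilDiscriminantNondeg B ψ n d
      ((d : ℂ) • complexBetti.map eB.ι 2 aB + complexBetti.map ψ.hom.hom.hom 2 (complexBetti.map eB.ι 2 aB)) δ)
    (Φ : A.prod B ⟶ A.prod B) (hΦ₁ : Φ ≫ AbelianVariety.fst A B = AbelianVariety.fst A B ≫ φ)
    (hΦ₂ : Φ ≫ AbelianVariety.snd A B = AbelianVariety.snd A B ≫ (-ψ)) :
    weilClassesOf (A.prod B) Φ (n + n) d ≤ algebraicClasses (A.prod B).X (n + n) :=
  weilClassesOf_twistedProd_le_algebraicClasses_of_splitHyperplane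
    (splitWeilAbelianVarieties_iff_forall_splitHyperplane.1 hR2 (n + n) (by omega) d hWA.d_pos)
    hWA hWB eA haA haA0 eB haB haB0 hδA hδB Φ hΦ₁ hΦ₂

/-- **Binder: the cell's split component `WeilClassesComponent (n + n) d [1]`** (`[1] = [(−1)^{2n}]`, `splitDiscriminantClass`)
⟹ the same conclusion (ab-weil-1's `weilClasses_algebraic_twistedProd_of_split_component` for the rational Hodge classes,
then van Geemen 4.9 for the plane). [cite: vanGeemen1994HodgeAV, 4.9, Lemma 5.2 (3) and (5.4.1)] -/
theorem weilClassesOf_twistedProd_le_algebraicClasses_of_split_component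
    (hC : WeilClassesComponent (n + n) d (splitDiscriminantClass (n + n) d))
    (hWA : IsWeilType A φ n d) (hWB : IsWeilType B ψ n d)
    (eA : ProjectiveEmbedding A.X) {aA : complexBetti (projectiveSpace eA.n ℂ) 2} (haA : IsRationalClass aA)
    (haA0 : aA ≠ 0)
    (eB : ProjectiveEmbedding B.X) {aB : complexBetti (projectiveSpace eB.n ℂ) 2} (haB : IsRationalClass aB)
    (haB0 : aB ≠ 0) {δ : weilNormResidueGroup d}
    (hδA : HasWeilDiscriminantNondeg A φ n d
      ((d : ℂ) • complexBetti.map eA.ι 2 aA + complexBetti.map φ.hom.hom.hom 2 (complexBetti.map eA.ι 2 aA)) δ)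
    (hδB : HasWeilDiscriminantNondeg B ψ n d
      ((d : ℂ) • complexBetti.map eB.ι 2 aB + complexBetti.map ψ.hom.hom.hom 2 (complexBetti.map eB.ι 2 aB)) δ)
    (Φ : A.prod B ⟶ A.prod B) (hΦ₁ : Φ ≫ AbelianVariety.fst A B = AbelianVariety.fst A B ≫ φ)
    (hΦ₂ : Φ ≫ AbelianVariety.snd A B = AbelianVariety.snd A B ≫ (-ψ)) :
    weilClassesOf (A.prod B) Φ (n + n) d ≤ algebraicClasses (A.prod B).X (n + n) := by
  have hS := isSplitWeilType_twistedProd_of_comm hWA hWB eA haA haA0 eB haB haB0 hδA hδB Φ hΦ₁ hΦ₂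
  exact hS.1.weilClassesOf_le_algebraicClasses fun c hc hr hH =>
    weilClasses_algebraic_of_isSplitWeilType_of_split_component hC hS hr hH hc

/-- **W₆, member level: for two `ℚ(√−d)`-Weil SIXFOLDS of one component `(3, d, δ)` the Weil plane of the twisted
TWELVEFOLD `(A × B, φ × (−ψ))` is algebraic granted `SplitWeilAbelianVarieties`** (used at `N = 6`: split twelvefolds — a rung of
the OPEN E-tower). This is the member-level form of the W₆ open instance of the André axis after part XLVIII
(RING2-MAP §AbelianAll (o149)); node level dominated by part XLIV-f (R2₈ + Schoen descent).
[cite: vanGeemen1994HodgeAV, (5.4.1)] [cite: Markman2025SurveySecant, §11.5 Step 2 and §12] -/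
theorem weilClassesOf_twistedTwelvefold_le_algebraicClasses_of_splitWeilAbelianVarieties (hR2 : SplitWeilAbelianVarieties)
    (hWA : IsWeilType A φ 3 d) (hWB : IsWeilType B ψ 3 d)
    (eA : ProjectiveEmbedding A.X) {aA : complexBetti (projectiveSpace eA.n ℂ) 2} (haA : IsRationalClass aA)
    (haA0 : aA ≠ 0)
    (eB : ProjectiveEmbedding B.X) {aB : complexBetti (projectiveSpace eB.n ℂ) 2} (haB : IsRationalClass aB)
    (haB0 : aB ≠ 0) {δ : weilNormResidueGroup d}
    (hδA : HasWeilDiscriminantNondeg A φ 3 d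
      ((d : ℂ) • complexBetti.map eA.ι 2 aA + complexBetti.map φ.hom.hom.hom 2 (complexBetti.map eA.ι 2 aA)) δ)
    (hδB : HasWeilDiscriminantNondeg B ψ 3 d
      ((d : ℂ) • complexBetti.map eB.ι 2 aB + complexBetti.map ψ.hom.hom.hom 2 (complexBetti.map eB.ι 2 aB)) δ) :
    weilClassesOf (A.prod B)
        (AbelianVariety.prodLift (AbelianVariety.fst A B ≫ φ) (AbelianVariety.snd A B ≫ (-ψ))) (3 + 3) d ≤
      algebraicClasses (A.prod B).X (3 + 3) :=
  weilClassesOf_twistedProd_le_algebraicClasses_of_splitWeilAbelianVarieties hR2 (by norm_num) hWA hWB eA haA haA0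
    eB haB haB0 hδA hδB _ (AbelianVariety.prodLift_fst _ _) (AbelianVariety.prodLift_snd _ _)

end Nodes

/-! ## §4 On-path: every statement of §3 is a case of the summit -/

section OnPath

variable {A B : AbelianVariety ℂ} {φ : A ⟶ A} {ψ : B ⟶ B} {n d : ℕ}

/-- **On-path**: under the Hodge conjecture the Weil plane of every isodiscriminantal twisted product is algebraic (the slice
`Stubs.WeilAlgebraicSplitHyperplane (n + n) d` is a case of the summit, ab-weil's `weilAlgebraicSplitHyperplane_of_hodgeConjecture`),
so §3 records CASES of the summit, not progress on it. [cite: Deligne2000, §1] -/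
theorem weilClassesOf_twistedProd_le_algebraicClasses_of_hodgeConjecture (h : _root_.HodgeConjecture)
    (hWA : IsWeilType A φ n d) (hWB : IsWeilType B ψ n d)
    (eA : ProjectiveEmbedding A.X) {aA : complexBetti (projectiveSpace eA.n ℂ) 2} (haA : IsRationalClass aA)
    (haA0 : aA ≠ 0)
    (eB : ProjectiveEmbedding B.X) {aB : complexBetti (projectiveSpace eB.n ℂ) 2} (haB : IsRationalClass aB)
    (haB0 : aB ≠ 0) {δ : weilNormResidueGroup d}
    (hδA : HasWeilDiscriminantNondeg A φ n d
      ((d : ℂ) • complexBetti.map eA.ι 2 aA + complexBetti.map φ.hom.hom.hom 2 (complexBetti.map eA.ι 2 aA)) δ)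
    (hδB : HasWeilDiscriminantNondeg B ψ n d
      ((d : ℂ) • complexBetti.map eB.ι 2 aB + complexBetti.map ψ.hom.hom.hom 2 (complexBetti.map eB.ι 2 aB)) δ)
    (Φ : A.prod B ⟶ A.prod B) (hΦ₁ : Φ ≫ AbelianVariety.fst A B = AbelianVariety.fst A B ≫ φ)
    (hΦ₂ : Φ ≫ AbelianVariety.snd A B = AbelianVariety.snd A B ≫ (-ψ)) :
    weilClassesOf (A.prod B) Φ (n + n) d ≤ algebraicClasses (A.prod B).X (n + n) :=
  weilClassesOf_twistedProd_le_algebraicClasses_of_splitHyperplane (weilAlgebraicSplitHyperplane_of_hodgeConjecture h _ _)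
    hWA hWB eA haA haA0 eB haB haB0 hδA hδB Φ hΦ₁ hΦ₂

end OnPath

end Summit.HodgeConjecture.HodgeConjecture.Ring2.AbelianAll

end
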